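import Mathlib
import HarnessLib
import Summits.HubbardSuperconductivity.HubbardSuperconductivity.Theorems.KLProgrammeKLRegimeSplitBornOddness

/-!
# Route `KLProgramme` — ENGINE (stmt-HubbardSuperconductivity-20437 `KLRegimeEngineV17F2`), row (c) binder #8 (v19 `hexLadMV`, EXCHANGE value row `RQ`), cure of located #23,
# brick O6d: THE FREQUENCY-SHIFT IDENTITY OF THE FRAME RUNG — `ĝ_K(ν′,k̃) − ĝ_K(ν,k̃) = i(ω_ν′ − ω_ν)·ĝ_K(ν,k̃)·ĝ_K(ν′,k̃)` — and the exchange bubble as the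
# direct (rotation) bubble plus a correction of size `|q₀|·Σ|a|·‖ĝ‖²‖ĝ′‖`
# (cell gate-hubbard-kl, seat hubbard-kl-k3c2-p2 g31, technique «thermal-bar induction n ≤ nScales β + 1 with EngineBoundsAtV4S sums»)

WHY.  At the exchanged pinned pair `k′ = Qm − k` the EXCHANGE p-h row `RQ` of binder #8 has zero SPATIAL transfer but its partner frequency is shifted by the pinned
transfer (`ω′ = ω + q₀`, `q₀ = 2ω₀ + 2π/β`-type; located #23 memo §4).  The rotation lemma (O6a–O6c: `Σ_p G ĝ_p²` is thermal + DOS-slope + lattice sized) treats the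
UNSHIFTED product; this file is the exact bridge: the resolvent identity for the frame rung and the resulting decomposition
`Σ_p a(p)·ĝ(p)·ĝ(p′) = Σ_p a(p)·ĝ(p)² + Σ_p a(p)·ĝ(p)·(ĝ(p′) − ĝ(p))`, whose second term is bounded by `|q₀|·Σ_p ‖a(p)‖·‖ĝ(p)‖²·‖ĝ(p′)‖` — one more rung than a
sign-blind mass, i.e. `∝ |q₀|/Λ` relative = THERMAL (`(π/β)/Λ`, home `thermalBar`) for the pinned transfers of the ladder.

* `klod_propCT_sub_propCT` — `ĝ(ν′,k̃) − ĝ(ν,k̃) = (I·(ω_ν′ − ω_ν))·ĝ(ν,k̃)·ĝ(ν′,k̃)` (`β ≠ 0`); `klod_norm_propCT_sub_propCT_le` — `‖ĝ(ν′) − ĝ(ν)‖ ≤ |ω_ν′ − ω_ν|·‖ĝ(ν)‖·‖ĝ(ν′)‖`;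
* `klod_norm_propCT_le_inv_abs_freq` — `‖ĝ_K(ν,k̃)‖ ≤ 1/|ω_ν|` (the rung never exceeds the inverse fermionic frequency, `≤ β/π`);
* `klod_sum_mul_mul_sub_sum_mul_sq_le` — model-free: `‖g′ i − g i‖ ≤ δ‖g i‖‖g′ i‖` for all `i` ⇒ `‖Σ a·g·g′ − Σ a·g²‖ ≤ δ·Σ ‖a‖‖g‖²‖g′‖`;
* **`klod_exchange_bubble_sub_direct_le`** — for any relabelling `σ` of the Matsubara set with `|ω_{σν} − ω_ν| ≤ q₀` and weights `a`:
  `‖Σ_{(ν,k̃)} a·ĝ(ν,k̃)·ĝ(σν,k̃) − Σ_{(ν,k̃)} a·ĝ(ν,k̃)²‖ ≤ q₀·Σ_{(ν,k̃)} ‖a‖·‖ĝ(ν,k̃)‖²·‖ĝ(σν,k̃)‖`.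
Pure identities/inequalities about `propCT`; no definitions; nothing asserts (c), K3 or superconductivity.  [cite: BenfattoGiulianiMastropietro2006, §2.5]
-/

noncomputable section

namespace Summit.HubbardSuperconductivity.HubbardSuperconductivity.Theorems.KLRegimeSplit

set_option linter.dupNamespace false -- summit = problem name (single-conjunct summit), D-0017

open Real Finset Literature.MathematicalPhysics.QuantumLattice Literature.Probability.LatticeModels
open Summit.HubbardSuperconductivity.HubbardSuperconductivity.Theorems.TwoPointAssembly

variable {L M : ℕ} {β : ℝ} (μ : ℝ) (K : TrigPolyC4v)

/-! ## §1 The resolvent identity of the frame rung in the frequency -/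

/-- **`ĝ(ν′,k̃) − ĝ(ν,k̃) = i(ω_ν′ − ω_ν)·ĝ(ν,k̃)·ĝ(ν′,k̃)`** (`ĝ = 1/(−iω + e_K)`, `β ≠ 0`). -/
theorem klod_propCT_sub_propCT (hβ : β ≠ 0) (ν ν' : MatsubaraIdx M) (k : TorusSite 2 L) :
    propCT L M β μ K (ν', k) - propCT L M β μ K (ν, k) =
      (Complex.I * ((matsubaraFreq β M ν' : ℂ) - (matsubaraFreq β M ν : ℂ))) * propCT L M β μ K (ν, k) * propCT L M β μ K (ν', k) := by
  obtain ⟨h1, h10⟩ := propCT_eq_one_div μ K hβ ((ν, k) : FreqMomentum L M)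
  obtain ⟨h2, h20⟩ := propCT_eq_one_div μ K hβ ((ν', k) : FreqMomentum L M)
  simp only at h1 h2 h10 h20
  set a : ℂ := -Complex.I * (matsubaraFreq β M ν : ℂ) + (nambuXiCT L μ K k : ℂ) with ha
  set a' : ℂ := -Complex.I * (matsubaraFreq β M ν' : ℂ) + (nambuXiCT L μ K k : ℂ) with ha'
  have hdiff : a - a' = Complex.I * ((matsubaraFreq β M ν' : ℂ) - (matsubaraFreq β M ν : ℂ)) := by rw [ha, ha']; ring
  rw [h1, h2, one_div, one_div, inv_sub_inv h20 h10, hdiff, div_eq_mul_inv, mul_inv, mul_assoc]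
  ring

/-- **`‖ĝ(ν′) − ĝ(ν)‖ ≤ |ω_ν′ − ω_ν|·‖ĝ(ν)‖·‖ĝ(ν′)‖.** -/
theorem klod_norm_propCT_sub_propCT_le (hβ : β ≠ 0) (ν ν' : MatsubaraIdx M) (k : TorusSite 2 L) :
    ‖propCT L M β μ K (ν', k) - propCT L M β μ K (ν, k)‖ ≤
      |matsubaraFreq β M ν' - matsubaraFreq β M ν| * ‖propCT L M β μ K (ν, k)‖ * ‖propCT L M β μ K (ν', k)‖ := by
  rw [klod_propCT_sub_propCT μ K hβ ν ν' k, norm_mul, norm_mul, norm_mul, Complex.norm_I, one_mul, ← Complex.ofReal_sub, Complex.norm_real,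
    Real.norm_eq_abs]

/-- **The rung never exceeds the inverse fermionic frequency**: `‖ĝ_K(ν,k̃)‖ ≤ 1/|ω_ν|` (`β ≠ 0`). -/
theorem klod_norm_propCT_le_inv_abs_freq (hβ : β ≠ 0) (ν : MatsubaraIdx M) (k : TorusSite 2 L) :
    ‖propCT L M β μ K (ν, k)‖ ≤ 1 / |matsubaraFreq β M ν| := by
  obtain ⟨h1, h10⟩ := propCT_eq_one_div μ K hβ ((ν, k) : FreqMomentum L M)
  have hω : matsubaraFreq β M ν ≠ 0 := matsubaraFreq_ne_zero hβ ν
  rw [h1, norm_div, norm_one]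
  refine div_le_div_of_nonneg_left zero_le_one (abs_pos.2 hω) ?_
  -- `|ω| = |Im(−iω + e)| ≤ ‖−iω + e‖`
  have him : (-Complex.I * (matsubaraFreq β M ν : ℂ) + (nambuXiCT L μ K k : ℂ)).im = -matsubaraFreq β M ν := by simp
  have h := Complex.abs_im_le_norm (-Complex.I * (matsubaraFreq β M ν : ℂ) + (nambuXiCT L μ K k : ℂ))
  rw [him, abs_neg] at h
  exact h

/-! ## §2 Exchange bubble = direct bubble + a one-more-rung correction -/

/-- **Model-free**: if `‖g′ i − g i‖ ≤ δ·‖g i‖·‖g′ i‖` for every `i ∈ s` then `‖Σ_s a·g·g′ − Σ_s a·g²‖ ≤ δ·Σ_s ‖a‖·‖g‖²·‖g′‖`. -/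
theorem klod_sum_mul_mul_sub_sum_mul_sq_le {ι : Type*} (s : Finset ι) (a g g' : ι → ℂ) {δ : ℝ}
    (h : ∀ i ∈ s, ‖g' i - g i‖ ≤ δ * ‖g i‖ * ‖g' i‖) :
    ‖∑ i ∈ s, a i * g i * g' i - ∑ i ∈ s, a i * g i ^ 2‖ ≤ δ * ∑ i ∈ s, ‖a i‖ * ‖g i‖ ^ 2 * ‖g' i‖ := by
  rw [← sum_sub_distrib, mul_sum]
  refine (norm_sum_le _ _).trans (sum_le_sum fun i hi => ?_)
  have e : a i * g i * g' i - a i * g i ^ 2 = a i * g i * (g' i - g i) := by ring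
  rw [e, norm_mul, norm_mul]
  calc ‖a i‖ * ‖g i‖ * ‖g' i - g i‖ ≤ ‖a i‖ * ‖g i‖ * (δ * ‖g i‖ * ‖g' i‖) :=
        mul_le_mul_of_nonneg_left (h i hi) (mul_nonneg (norm_nonneg _) (norm_nonneg _))
    _ = δ * (‖a i‖ * ‖g i‖ ^ 2 * ‖g' i‖) := by ring

/-- **EXCHANGE BUBBLE VS DIRECT BUBBLE.**  For any relabelling `σ` of the Matsubara set with `|ω_{σν} − ω_ν| ≤ q₀` for all `ν` and any weights `a`:
`‖Σ_{(ν,k̃)} a(ν,k̃)·ĝ(ν,k̃)·ĝ(σν,k̃) − Σ_{(ν,k̃)} a(ν,k̃)·ĝ(ν,k̃)²‖ ≤ q₀·Σ_{(ν,k̃)} ‖a(ν,k̃)‖·‖ĝ(ν,k̃)‖²·‖ĝ(σν,k̃)‖` — the direct bubble is the rotation lemma's object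
(O6a–O6c); the correction carries ONE MORE RUNG (`≤ 1/|ω|`) times the frequency transfer `q₀`, i.e. it is `∝ q₀/Λ` relative to the sign-blind mass (thermal for pinned transfers).
[cite: BenfattoGiulianiMastropietro2006, §2.5] -/
theorem klod_exchange_bubble_sub_direct_le [NeZero L] (hβ : β ≠ 0) (σ : MatsubaraIdx M → MatsubaraIdx M) {q₀ : ℝ}
    (hσ : ∀ ν, |matsubaraFreq β M (σ ν) - matsubaraFreq β M ν| ≤ q₀) (a : FreqMomentum L M → ℂ) :
    ‖∑ p : FreqMomentum L M, a p * propCT L M β μ K p * propCT L M β μ K (σ p.1, p.2) - ∑ p : FreqMomentum L M, a p * propCT L M β μ K p ^ 2‖ ≤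
      q₀ * ∑ p : FreqMomentum L M, ‖a p‖ * ‖propCT L M β μ K p‖ ^ 2 * ‖propCT L M β μ K (σ p.1, p.2)‖ := by
  refine klod_sum_mul_mul_sub_sum_mul_sq_le univ a (fun p => propCT L M β μ K p) (fun p => propCT L M β μ K (σ p.1, p.2)) fun p _ => ?_
  have h := klod_norm_propCT_sub_propCT_le μ K hβ p.1 (σ p.1) p.2
  calc ‖propCT L M β μ K (σ p.1, p.2) - propCT L M β μ K p‖ = ‖propCT L M β μ K (σ p.1, p.2) - propCT L M β μ K (p.1, p.2)‖ := rfl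
    _ ≤ |matsubaraFreq β M (σ p.1) - matsubaraFreq β M p.1| * ‖propCT L M β μ K (p.1, p.2)‖ * ‖propCT L M β μ K (σ p.1, p.2)‖ := h
    _ ≤ q₀ * ‖propCT L M β μ K p‖ * ‖propCT L M β μ K (σ p.1, p.2)‖ := by
        gcongr
        exact hσ p.1

end Summit.HubbardSuperconductivity.HubbardSuperconductivity.Theorems.KLRegimeSplit

end
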